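import Mathlib
import Literature.AlgebraicGeometry.Resolution.ResolutionOfSingularities
import Literature.AlgebraicGeometry.Resolution.StalkBaseChangeChart
import Summits.ResolutionOfSingularities.ResolutionOfSingularities.Theorems.PicoverLocalModel.Negative.PowerDichotomy
import Summits.ResolutionOfSingularities.ResolutionOfSingularities.Theorems.PicoverLocalModel.Negative.WeakResolutionFiniteNormalization
import Summits.ResolutionOfSingularities.ResolutionOfSingularities.Theorems.PAlterationPicoverToRadicialBottomReducedPullback

/-!
# Crux `PicoverLocalModel` (stmt-ResolutionOfSingularities-0557), line `SketchIdeator3`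
# (giraud-cossart-normal-form) — stub `stub_pullbackIntegral`

**The pulled-back purely inseparable cover stays integral.** Let `R` be a normal domain of
characteristic `p`, `a ∈ R ∖ R^p`, `X_a = Spec R[T]/(T^p - a)` and `π : W → Spec R` a birational
morphism from an integral scheme `W`. Then `X_a ×_{Spec R} W` is an integral scheme:

* *irreducible*: `X_a → Spec R` is finite, surjective and universally injective (one `p`-th root
  per geometric fibre), so its base change `X_a ×_R W → W` is a homeomorphism
  (`irreducibleSpace_pullback_of_isIntegralHom`);
* *reduced*, checked on local rings through the flat charts `Spec (𝒪_{W,y} ⊗_R R[T]/(T^p - a))`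
  of `W ×_R X_a` (`stalkTensorChart`, isomorphisms on local rings): the ring
  `𝒪_{W,y} ⊗_R R[T]/(T^p - a) ≅ 𝒪_{W,y}[T]/(T^p - a)` is a domain, because `𝒪_{W,y}` is a domain
  with fraction field `K(W)` and `a` is not a `p`-th power in `K(W)` — the generic fibre
  `Spec (Frac R) → W` of the birational `π` gives a ring map `K(W) = 𝒪_{W,ξ} → Frac R` under `R`,
  and `a ∉ (Frac R)^p` by normality (`Negative.not_pow_fractionRing`) — so that
  `𝒪_{W,y}[T]/(T^p - a)` embeds in the field `K(W)[T]/(T^p - a)`.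

Everything here is folklore bookkeeping around Mathlib's scheme library.
-/

noncomputable section

-- single-problem summit: the doubled namespace component `ResolutionOfSingularities` is the tree layout
set_option linter.dupNamespace false

open CategoryTheory CategoryTheory.Limits AlgebraicGeometry TopologicalSpace Polynomial
open Literature.AlgebraicGeometry.Resolution
open scoped TensorProduct

namespace Summit.ResolutionOfSingularities.ResolutionOfSingularities.Theorems.PicoverLocalModel.PullbackIntegral

open Summit.ResolutionOfSingularities.ResolutionOfSingularities.Theorems.PicoverLocalModel.Negative

/-! ## The structure maps `R → 𝒪_{W,x}` of an `R`-scheme and the function field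

Throughout, the structure map `R → 𝒪_{W,x}` of `π : W → Spec R` at a point `x` is written
`Spec.preimage (W.fromSpecStalk x ≫ π)`: the ring map whose `Spec` is `Spec 𝒪_{W,x} → W → Spec R`
(`Spec` is fully faithful; `Spec.map_preimage`). -/

section StalkMaps

variable {R : Type} [CommRing R] {W : Scheme.{0}} (π : W ⟶ Spec (.of R))

/-- The structure maps are compatible with generization to the generic point:
`R → 𝒪_{W,x} → 𝒪_{W,ξ} = K(W)` is the structure map of `K(W)`. [folklore] -/
theorem algebraMap_comp_preimage [IsIntegral W] (x : W) :
    (algebraMap (W.presheaf.stalk x) W.functionField).comp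
        (Spec.preimage (W.fromSpecStalk x ≫ π)).hom =
      (Spec.preimage (W.fromSpecStalk (genericPoint W) ≫ π)).hom := by
  have h1 : Spec.map (Spec.preimage (W.fromSpecStalk x ≫ π) ≫
      CommRingCat.ofHom (algebraMap (W.presheaf.stalk x) W.functionField)) =
      Spec.map (Spec.preimage (W.fromSpecStalk (genericPoint W) ≫ π)) := by
    rw [Spec.map_comp, Spec.map_preimage, Spec.map_preimage, RingHom.algebraMap_toAlgebra,
      CommRingCat.ofHom_hom, Scheme.SpecMap_stalkSpecializes_fromSpecStalk_assoc]
  exact congrArg CommRingCat.Hom.hom (Spec.map_injective h1)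

/-- The `R`-algebra structure of the synonym `StalkOver π y₀` of `𝒪_{W,y₀}`
(`Literature.AlgebraicGeometry.Resolution.StalkOver`) is the structure map at `y₀`. [folklore] -/
theorem algebraMap_stalkOver_eq (y₀ : W) :
    (CommRingCat.ofHom (algebraMap R (StalkOver π y₀)) : CommRingCat.of R ⟶ W.presheaf.stalk y₀) =
      Spec.preimage (W.fromSpecStalk y₀ ≫ π) := by
  apply Spec.map_injective
  have h1 : StalkOver.fromSpec π y₀ = W.fromSpecStalk y₀ := by
    unfold StalkOver.fromSpec StalkOver.iso
    erw [Iso.refl_hom, Spec.map_id, Category.id_comp]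
  have h2 := fromSpecStalk_comp_eq π y₀
  rw [h1] at h2
  exact h2.symm.trans (Spec.map_preimage _).symm

/-- Pointwise form of `algebraMap_stalkOver_eq`. [folklore] -/
theorem algebraMap_stalkOver_apply (y₀ : W) (r : R) :
    (algebraMap R (StalkOver π y₀) r : W.presheaf.stalk y₀) =
      (Spec.preimage (W.fromSpecStalk y₀ ≫ π)).hom r := by
  rw [← algebraMap_stalkOver_eq]
  rfl

variable (p : ℕ) [hp : Fact p.Prime] [IsDomain R] [IsIntegrallyClosed R] {a : R}
  (ha : ∀ b : R, b ^ p ≠ a)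

include ha in
/-- **`a` is not a `p`-th power in `K(W)`** for `π : W → Spec R` birational, `W` integral, `R` a
normal domain and `a ∉ R^p`: the generic fibre `i : Spec (Frac R) → W` of `π` hits the generic
point `ξ`, and the induced ring map `K(W) = 𝒪_{W,ξ} → Frac R` is compatible with the structure
maps from `R`, so a `p`-th root of `a` in `K(W)` would give one in `Frac R`, contradicting
normality (`Negative.not_pow_fractionRing`). [folklore] -/
theorem not_pow_stalk_genericPoint [IsIntegral W] (hπ : IsBirational π)
    (c : W.presheaf.stalk (genericPoint W)) :
    c ^ p ≠ (Spec.preimage (W.fromSpecStalk (genericPoint W) ≫ π)).hom a := by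
  obtain ⟨U, hU, -, hiso⟩ := hπ
  haveI := hiso
  obtain ⟨i₁, hi₁, hgen⟩ := exists_genericPoint_lift (F := FractionRing R) π U hU
  have key : ∀ c : W.presheaf.stalk (i₁ (IsLocalRing.closedPoint (FractionRing R))),
      c ^ p ≠ (Spec.preimage (W.fromSpecStalk _ ≫ π)).hom a := by
    intro c hc
    set θ := Scheme.stalkClosedPointTo i₁ with hθdef
    have h1 : Spec.map (Spec.preimage (W.fromSpecStalk _ ≫ π) ≫ θ) =
        Spec.map (CommRingCat.ofHom (algebraMap R (FractionRing R))) := by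
      rw [Spec.map_comp, Spec.map_preimage, Scheme.Spec_stalkClosedPointTo_fromSpecStalk_assoc]
      exact hi₁
    have h2 : θ.hom.comp (Spec.preimage (W.fromSpecStalk _ ≫ π)).hom =
        algebraMap R (FractionRing R) :=
      congrArg CommRingCat.Hom.hom (Spec.map_injective h1)
    apply not_pow_fractionRing p R ha (θ.hom c)
    rw [← map_pow, hc, ← RingHom.comp_apply, h2]
  have hx : i₁ (IsLocalRing.closedPoint (FractionRing R)) = genericPoint W := hgen _
  rw [hx] at key
  exact key c

include ha in
/-- `a` is not a `p`-th power in `K(W)`, with `a` pushed along `R → 𝒪_{W,x} → K(W)` for any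
point `x` of `W`. [folklore] -/
theorem not_pow_functionField [IsIntegral W] (hπ : IsBirational π) (x : W)
    (c : W.functionField) :
    c ^ p ≠ algebraMap (W.presheaf.stalk x) W.functionField
      ((Spec.preimage (W.fromSpecStalk x ≫ π)).hom a) := by
  rw [← RingHom.comp_apply, algebraMap_comp_preimage]
  exact not_pow_stalk_genericPoint π p ha hπ c

include ha in
/-- `a` is not a `p`-th power in `K(W)`, with `a` pushed along the `R`-algebra structure of the
synonym `StalkOver π y₀` of `𝒪_{W,y₀}`. [folklore] -/
theorem not_pow_stalkOver [IsIntegral W] (hπ : IsBirational π) (y₀ : W) (c : W.functionField) :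
    c ^ p ≠ algebraMap (W.presheaf.stalk y₀) W.functionField
      (algebraMap R (StalkOver π y₀) a : W.presheaf.stalk y₀) := by
  rw [algebraMap_stalkOver_apply]
  exact not_pow_functionField π p ha hπ y₀ c

end StalkMaps

/-! ## Algebra: `S[T]/(T^p - b)` is a domain, and base change of `R[T]/(T^p - a)` -/

section Algebra

/-- **`S[T]/(T^p - b)` is a domain** when `S` is a domain with fraction field `K` and `b` is not a
`p`-th power in `K`: it embeds in the field `K[T]/(T^p - b)` (`T^p - b` irreducible over `K`,
`X_pow_sub_C_irreducible_of_prime`; injectivity by comparing degrees, `Negative.liftAlgHom_injective`).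
[folklore] -/
theorem isDomain_adjoinRoot_of_not_pow_of_isFractionRing (p : ℕ) [hp : Fact p.Prime]
    {S K : Type} [CommRing S] [IsDomain S] [Field K] [Algebra S K] [IsFractionRing S K]
    {b : S} (hb : ∀ c : K, c ^ p ≠ algebraMap S K b) :
    IsDomain (AdjoinRoot ((X : S[X]) ^ p - C b)) := by
  have hirr : Irreducible ((X : K[X]) ^ p - C (algebraMap S K b)) :=
    X_pow_sub_C_irreducible_of_prime hp.out hb
  haveI : Fact (Irreducible ((X : K[X]) ^ p - C (algebraMap S K b))) := ⟨hirr⟩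
  set F := AdjoinRoot ((X : K[X]) ^ p - C (algebraMap S K b))
  have hy : ((X : S[X]) ^ p - C b).eval₂ (Algebra.ofId S F : S →+* F) (AdjoinRoot.root _) = 0 := by
    have := AdjoinRoot.eval₂_root ((X : K[X]) ^ p - C (algebraMap S K b))
    rw [eval₂_sub, eval₂_X_pow, eval₂_C] at this ⊢
    rw [sub_eq_zero] at this ⊢
    rw [this]
    rfl
  have hmin : (minpoly K (AdjoinRoot.root ((X : K[X]) ^ p - C (algebraMap S K b)))).degree =
      ((X : S[X]) ^ p - C b).degree := by
    rw [AdjoinRoot.minpoly_root hirr.ne_zero, degree_mul, degree_C (inv_ne_zero (by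
      rw [(monic_X_pow_sub_C _ hp.out.ne_zero).leadingCoeff]; exact one_ne_zero)), add_zero,
      degree_X_pow_sub_C hp.out.pos, degree_X_pow_sub_C hp.out.pos]
  have hinj := liftAlgHom_injective (K := K) (monic_X_pow_sub_C b hp.out.ne_zero) _ hy hmin
  exact Function.Injective.isDomain _ hinj

/-- **Base change of the model ring**: `O ⊗_R R[T]/(T^p - a) ≅ O[T]/(T^p - a)` (Mathlib's
`AdjoinRoot.tensorAlgEquiv` and `AdjoinRoot.mapRingEquiv` along `O ⊗_R R ≅ O`); in particular
the left side is a domain when the right side is. [folklore] -/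
theorem isDomain_tensor_adjoinRoot (p : ℕ) {R O : Type} [CommRing R]
    [CommRing O] [Algebra R O] (a : R)
    [IsDomain (AdjoinRoot ((X : O[X]) ^ p - C (algebraMap R O a)))] :
    IsDomain (O ⊗[R] AdjoinRoot ((X : R[X]) ^ p - C a)) := by
  set f : R[X] := X ^ p - C a
  let e₁ := AdjoinRoot.tensorAlgEquiv (R := R) (S := R) (T := O) f _ rfl
  have hcomp : ((Algebra.TensorProduct.rid R O O).toRingEquiv.toRingHom).comp
      (Algebra.TensorProduct.includeRight (R := R) (A := O) (B := R)).toRingHom =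
        algebraMap R O := by
    ext r
    simp [Algebra.TensorProduct.includeRight_apply, Algebra.algebraMap_eq_smul_one]
  have hmap : (f.map (Algebra.TensorProduct.includeRight (R := R) (A := O) (B := R)).toRingHom).map
      ((Algebra.TensorProduct.rid R O O).toRingEquiv.toRingHom) =
        (X : O[X]) ^ p - C (algebraMap R O a) := by
    rw [Polynomial.map_map, hcomp]
    simp [f]
  let e₂ := AdjoinRoot.mapRingEquiv (Algebra.TensorProduct.rid R O O).toRingEquiv
    (f.map (Algebra.TensorProduct.includeRight (R := R) (A := O) (B := R)).toRingHom)
    ((X : O[X]) ^ p - C (algebraMap R O a)) (hmap ▸ Associated.refl _)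
  exact (e₁.toRingEquiv.trans e₂).toMulEquiv.isDomain

end Algebra

/-! ## The model `X_a → Spec R` is finite, surjective and universally injective -/

section Model

variable (p : ℕ) [hp : Fact p.Prime] (R : Type) [CommRing R] (a : R)

/-- `X_a = Spec R[T]/(T^p - a) → Spec R` is **finite** (`R[T]/(T^p - a)` is a finite free
`R`-module). [folklore] -/
theorem isFinite_model :
    IsFinite (Spec.map (CommRingCat.ofHom (algebraMap R (AdjoinRoot ((X : R[X]) ^ p - C a))))) := by
  rw [IsFinite.SpecMap_iff, CommRingCat.hom_ofHom, RingHom.finite_algebraMap]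
  exact (monic_X_pow_sub_C a hp.out.ne_zero).finite_adjoinRoot

/-- `X_a → Spec R` is **surjective** (lying over for the injective integral extension
`R ⊆ R[T]/(T^p - a)`). [folklore] -/
theorem surjective_model [IsDomain R] :
    Surjective (Spec.map (CommRingCat.ofHom (algebraMap R (AdjoinRoot ((X : R[X]) ^ p - C a))))) := by
  have hp0 : p ≠ 0 := hp.out.ne_zero
  haveI : Module.Finite R (AdjoinRoot ((X : R[X]) ^ p - C a)) :=
    (monic_X_pow_sub_C a hp0).finite_adjoinRoot
  have hinj : Function.Injective (algebraMap R (AdjoinRoot ((X : R[X]) ^ p - C a))) :=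
    AdjoinRoot.of.injective_of_degree_ne_zero (by
      rw [degree_X_pow_sub_C (Nat.pos_of_ne_zero hp0)]
      exact_mod_cast hp0)
  have hint : (algebraMap R (AdjoinRoot ((X : R[X]) ^ p - C a))).IsIntegral :=
    Algebra.IsIntegral.isIntegral
  have hsurj : Function.Surjective
      (PrimeSpectrum.comap (algebraMap R (AdjoinRoot ((X : R[X]) ^ p - C a)))) :=
    hint.comap_surjective hinj
  refine ⟨fun x => ?_⟩
  obtain ⟨q, hq⟩ := hsurj x
  exact ⟨q, hq⟩

/-- `X_a → Spec R` is **universally injective** (radicial): two `K`-points of `X_a` over the same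
`K`-point of `Spec R` agree, a `p`-th root of `a` in a field of characteristic `p` being unique.
[folklore] -/
theorem universallyInjective_model [CharP R p] :
    UniversallyInjective
      (Spec.map (CommRingCat.ofHom (algebraMap R (AdjoinRoot ((X : R[X]) ^ p - C a))))) := by
  refine ((tfae_universallyInjective
    (Spec.map (CommRingCat.ofHom (algebraMap R (AdjoinRoot ((X : R[X]) ^ p - C a)))))).out 1 0).mp ?_
  intro K _ g₁ g₂ h
  obtain ⟨φ₁, rfl⟩ := Spec.map_surjective g₁
  obtain ⟨φ₂, rfl⟩ := Spec.map_surjective g₂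
  change Spec.map φ₁ ≫ _ = Spec.map φ₂ ≫ _ at h
  rw [← Spec.map_comp, ← Spec.map_comp] at h
  have h' := congrArg (fun ψ => ψ.hom) (Spec.map_injective h)
  simp only [CommRingCat.hom_comp, CommRingCat.hom_ofHom] at h'
  have hchar : CharP K p := (CharP.charP_iff_prime_eq_zero hp.out).mpr (by
    rw [← map_natCast (φ₁.hom.comp (algebraMap R _)) p, CharP.cast_eq_zero, map_zero])
  haveI := hchar
  haveI : ExpChar K p := ExpChar.prime hp.out
  congr 1
  ext : 1
  refine AdjoinRoot.ringHom_ext ?_ ?_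
  · exact h'
  · apply frobenius_inj K p
    simp only [frobenius_def, ← map_pow]
    have hroot : AdjoinRoot.root ((X : R[X]) ^ p - C a) ^ p = AdjoinRoot.of _ a := by
      have h := AdjoinRoot.eval₂_root ((X : R[X]) ^ p - C a)
      rwa [eval₂_sub, eval₂_X_pow, eval₂_C, sub_eq_zero] at h
    rw [hroot]
    exact congrArg (fun ψ => ψ a) h'

end Model

/-! ## Reducedness of `W ×_{Spec R} X_a` through the stalk charts -/

section Reduced

variable (p : ℕ) [hp : Fact p.Prime] (R : Type) [CommRing R] [IsDomain R] [IsIntegrallyClosed R]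
  {a : R} (ha : ∀ b : R, b ^ p ≠ a) (W : Scheme.{0}) (π : W ⟶ Spec (.of R)) [IsIntegral W]

include ha in
/-- The chart ring `𝒪_{W,y₀} ⊗_R R[T]/(T^p - a) ≅ 𝒪_{W,y₀}[T]/(T^p - a)` is a domain: `𝒪_{W,y₀}`
is a domain with fraction field `K(W)`, in which `a` is not a `p`-th power. [folklore] -/
theorem isDomain_stalkOver_tensor (hπ : IsBirational π) (y₀ : W) :
    IsDomain (StalkOver π y₀ ⊗[R] AdjoinRoot ((X : R[X]) ^ p - C a)) := by
  letI : Algebra (StalkOver π y₀) W.functionField :=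
    inferInstanceAs (Algebra (W.presheaf.stalk y₀) W.functionField)
  haveI : IsFractionRing (StalkOver π y₀) W.functionField :=
    inferInstanceAs (IsFractionRing (W.presheaf.stalk y₀) W.functionField)
  haveI : IsDomain (StalkOver π y₀) := inferInstanceAs (IsDomain (W.presheaf.stalk y₀))
  have hb : ∀ c : W.functionField,
      c ^ p ≠ algebraMap (StalkOver π y₀) W.functionField (algebraMap R (StalkOver π y₀) a) :=
    not_pow_stalkOver π p ha hπ y₀
  haveI := isDomain_adjoinRoot_of_not_pow_of_isFractionRing p hb
  exact isDomain_tensor_adjoinRoot p a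

include ha in
/-- **`W ×_{Spec R} X_a` is reduced**: every point lies in the image of a stalk chart
`Spec (𝒪_{W,y₀} ⊗_R R[T]/(T^p - a)) → W ×_R X_a`, a flat preimmersion inducing isomorphisms on
local rings, whose source is the spectrum of a domain. [folklore] -/
theorem isReduced_pullback (hπ : IsBirational π) :
    IsReduced
      ↑(pullback π (Spec.map (CommRingCat.ofHom (algebraMap R (AdjoinRoot ((X : R[X]) ^ p - C a)))))) := by
  refine @isReduced_of_isReduced_stalk _ (fun t => ?_)
  set y₀ := pullback.fst π
    (Spec.map (CommRingCat.ofHom (algebraMap R (AdjoinRoot ((X : R[X]) ^ p - C a))))) t with hy₀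
  obtain ⟨s, hs⟩ := exists_stalkTensorChart_eq (AdjoinRoot ((X : R[X]) ^ p - C a)) π y₀ t
    (by rw [hy₀])
  rw [← hs]
  haveI := isDomain_stalkOver_tensor p R ha W π hπ y₀
  let e := (asIso ((stalkTensorChart (AdjoinRoot ((X : R[X]) ^ p - C a)) π y₀).stalkMap
    s)).commRingCatIsoToRingEquiv
  exact isReduced_of_injective e.toRingHom e.injective

end Reduced

/-! ## The stub -/

/-- **The pulled-back torsor stays integral** (registered stub `stub_pullbackIntegral` of the line
`SketchIdeator3` of crux stmt-ResolutionOfSingularities-0557): for `R` a normal domain of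
characteristic `p`, `a ∉ R^p`, and `π : W → Spec R` birational with `W` integral, the scheme
`X_a ×_{Spec R} W` is integral — irreducible because `X_a → Spec R` is finite, surjective and
universally injective (so `X_a ×_R W → W` is a homeomorphism), and reduced because its local rings
are local rings of the domains `𝒪_{W,y}[T]/(T^p - a)` (`a` is not a `p`-th power in
`K(W) ↪ Frac R`, by normality of `R`). [folklore] -/
theorem stub_pullbackIntegral : ∀ (p : ℕ) [Fact p.Prime] (R : Type) [CommRing R] [IsDomain R]
    [IsIntegrallyClosed R] [CharP R p] (a : R), (∀ b : R, b ^ p ≠ a) →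
    ∀ (W : Scheme.{0}) (π : W ⟶ Spec (.of R)) [IsIntegral W], IsBirational π →
      IsIntegral (pullback
        (Spec.map (CommRingCat.ofHom (algebraMap R (AdjoinRoot ((X : R[X]) ^ p - C a))))) π) := by
  intro p _ R _ _ _ _ a ha W π _ hπ
  haveI := isFinite_model p R a
  haveI := universallyInjective_model p R a
  haveI := surjective_model p R a
  haveI : IrreducibleSpace
      ↑(pullback (Spec.map (CommRingCat.ofHom (algebraMap R (AdjoinRoot ((X : R[X]) ^ p - C a))))) π) :=
    Summit.ResolutionOfSingularities.ResolutionOfSingularities.Theorems.irreducibleSpace_pullback_of_isIntegralHom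
      _ π
  haveI := isReduced_pullback p R ha W π hπ
  haveI : IsReduced
      ↑(pullback (Spec.map (CommRingCat.ofHom (algebraMap R (AdjoinRoot ((X : R[X]) ^ p - C a))))) π) :=
    isReduced_of_isOpenImmersion (pullbackSymmetry _ _).hom
  exact isIntegral_of_irreducibleSpace_of_isReduced _

end Summit.ResolutionOfSingularities.ResolutionOfSingularities.Theorems.PicoverLocalModel.PullbackIntegral

end
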